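import Summits.CriticalPhenomena.PercolationContinuityZ3.Theorems.Transplant.KNCells2SepQ
import Summits.CriticalPhenomena.PercolationContinuityZ3.Theorems.Transplant.KNCells2CorridorSub
import Summits.CriticalPhenomena.PercolationContinuityZ3.Theorems.Transplant.KNCells2FaceSub
import Summits.CriticalPhenomena.PercolationContinuityZ3.Theorems.Transplant.KNCells2RootSub
import Summits.CriticalPhenomena.PercolationContinuityZ3.Theorems.Transplant.SkelTubeLevels
import HarnessLib

/-!
# (α) of §p2 2.0 item 4: the three SUBBOX reductions in the WINDOW GRAPH `winGraph G w₀ R` (generic twin of `KNCells2TubeSub`) — the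
# `hsub` hypotheses of the corridor chain (law `Wcor`), of the face step (law `Wt`) and of the root chain (law `W0sub`) for ANY lag-1
# anchored scheme `S : KSchA V A` over ANY graph, reduced to their instance content: "the fresh region lies in the ball `B_G(w₀, R)`" and
# "the lineage's own sets are WINDOW-adjacent to it"

builds on p205010 (kernel theorem, internal audit signed; external expert review pending) — nothing in this file uses p205010.
Lane `prim-bschramm-*`, seat `prim-bschramm-p2` (gen 3); helper file (`--supports stmt-CriticalPhenomena-4575`).

Dictionary (SHEAR-SCOPE §3.1, p1-g7's `SkelTubeLevels`): `tubeGraph X π ↦ Skel.winGraph G w₀ R` (edges of `G` inside the graph ball),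
`u.1 ∈ π ↦ u ∈ graphBall G w₀ R`, `U.filter (·.1 ∈ π) ↦ U.filter (· ∈ graphBall G w₀ R)`.  The generic halves are p2-g2's `isSubbox_Wcor_graph`
(p217063), `isSubbox_Wt_graph` (p217253), `isSubbox_W0sub_graph` (p221247) and the separation layer `QSepGeom` / `disjoint_Vx_of_fresh` /
`mem_of_adj_fresh` (p221141) — all already over an arbitrary vertex type.
* **`isSubbox_Wcor_win`** (corridor law), **`isSubbox_Wt_win`** (face law), **`isSubbox_W0sub_win`** (root law cut to the ball).
The remaining instance obligation `hout` ("a vertex of `E_{v,x} ∪ H` resp. `E_{v,x} ∪ E^far` adjacent to the fresh region lies in the ball") is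
a DEPTH bound: it holds as soon as `R` dominates the radii of those regions (`Skel.cellGeomSG`: `rB`, `rQ'`, `ρ`, resp. `rE`); note that the
product's planar-edge trick for the `cond_j` habitat (`tube_adj_of_mem_Ewv_Efar`: an `E_{v,x}`-neighbour of the far region is joined by a PLANAR
edge, hence has the same fibre) has no generic twin — over a skeleton take the window radius `R ≥ max (rB, rQ', rE)` for the face law too.
[cite: KozmaNitzan2024, §4 p. 17 (subbox), p. 26 ((29)), p. 28, p. 30, p. 31] [cite: GrimmettPercolation1999, §7.2]
-/

noncomputable section

open scoped Classical

namespace Summit.CriticalPhenomena.PercolationContinuityZ3.Theorems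

namespace Transplant

namespace Skel

open Literature.Probability.Percolation Literature.Probability.LatticeModels SimpleGraph GadgetSystem ProbeHistory HSiteScheme Contour KNCells
open KNCells.KSchA
open Literature.Barriers.CriticalPhenomena (graphBall)

variable {V : Type} [DecidableEq V] (G : SimpleGraph V) [G.LocallyFinite]
variable {A : Type*} {S : KSchA V A} {FD : FaceData V A} {LD : LevelData V A}
variable {h : ProbeHistory V} {e : Site 2 × MDir} {a a' b : A} {du : MDir}

/-- **The corridor law `Wcor` is a subbox weighting of the window graph on a fresh region `Dd`** inside the ball `B_G(w₀, R)`, the habitat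
`Q_b(x) ∪ E^far_{a'}(x,du)`, `Sx` and `Ucor`, provided every vertex of `E_{v,x} ∪ H_{x,y}` adjacent to `Dd` lies in the ball (the explored
region cannot touch `Dd`: `QSepGeom` + validity). [cite: KozmaNitzan2024, §4 p. 17 (subbox), p. 31] -/
theorem isSubbox_Wcor_win (w₀ : V) (R : ℕ) (hL : LevelGeom G S.Γ FD LD) (hQ : QSepGeom G S.Γ) (hV : S.Valid₂ G h e)
    (hdu : du ∈ S.onward G h (tgt e)) {Dd : Finset V} (hDh : Dd ⊆ S.Γ.Q b (tgt e) ∪ S.Γ.Efar a' (tgt e) du)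
    (hD : Dd ⊆ S.Sx G h e a a' du) (hDU : Dd ⊆ S.Ucor G FD h e a a' du) (hπ : ∀ u ∈ Dd, u ∈ graphBall G w₀ R)
    (hout : ∀ v ∈ Dd, ∀ x ∈ S.Γ.Ewv a e.1 e.2 ∪ FD.Hfull a' (tgt e) du, G.Adj x v → x ∈ graphBall G w₀ R) :
    KNLevels.IsSubbox (winGraph G w₀ R) (S.Wcor G FD h e a a' du) S.p Dd :=
  isSubbox_Wcor_graph (winGraph G w₀ R) (winGraph_le G w₀ R) hV.F_eq hD hDU (disjoint_Vx_of_fresh hL hQ hV hdu hDh)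
    (fun u hu v hv hadj => (winGraph_adj G).2 ⟨hadj, hπ u hu, hπ v hv⟩)
    (fun v hv x hx _ hadj => (winGraph_adj G).2 ⟨hadj, hout v hv x (mem_of_adj_fresh hL hQ hV hdu hDh hv hx hadj) hadj, hπ v hv⟩)

/-- **The face law `Wt` is a subbox weighting of the window graph on a fresh region `Dd`** inside the ball, the habitat
`Q_b(x) ∪ E^far_{a'}(x,du)` and `Sx`, disjoint from `E_{v,x} ∪ Stub_j`, provided every vertex of `E_{v,x} ∪ E^far` adjacent to `Dd` lies in
the ball. [cite: KozmaNitzan2024, §4 p. 17 (subbox), p. 30 (Step III)] -/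
theorem isSubbox_Wt_win (w₀ : V) (R : ℕ) (hL : LevelGeom G S.Γ FD LD) (hQ : QSepGeom G S.Γ) (hV : S.Valid₂ G h e)
    (hdu : du ∈ S.onward G h (tgt e)) {j : ℕ} {o : Finset (Sym2 V)} {Dd : Finset V}
    (hDh : Dd ⊆ S.Γ.Q b (tgt e) ∪ S.Γ.Efar a' (tgt e) du) (hD : Dd ⊆ S.Sx G h e a a' du)
    (hdis : Disjoint Dd (S.Γ.Ewv a e.1 e.2 ∪ S.Γ.Stub a' (tgt e) du j)) (hπ : ∀ u ∈ Dd, u ∈ graphBall G w₀ R)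
    (hout : ∀ v ∈ Dd, ∀ x ∈ S.Γ.Ewv a e.1 e.2 ∪ S.Γ.Efar a' (tgt e) du, G.Adj x v → x ∈ graphBall G w₀ R) :
    KNLevels.IsSubbox (winGraph G w₀ R) (S.Wt G h e a a' du j o) S.p Dd :=
  isSubbox_Wt_graph (winGraph G w₀ R) (winGraph_le G w₀ R) hD
    (Finset.disjoint_union_right.2 ⟨Finset.disjoint_union_right.2
      ⟨disjoint_Vx_of_fresh hL hQ hV hdu hDh, (Finset.disjoint_union_right.1 hdis).1⟩, (Finset.disjoint_union_right.1 hdis).2⟩)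
    (fun u hu v hv hadj => (winGraph_adj G).2 ⟨hadj, hπ u hu, hπ v hv⟩)
    (fun v hv x hx _ hadj => (winGraph_adj G).2 ⟨hadj, hout v hv x (mem_Sx_of_adj_fresh hL hQ hV hdu hDh hv hx hadj) hadj, hπ v hv⟩)

/-- **The root law cut to the ball, `W0sub (U.filter (· ∈ B_G(w₀, R)))`, is a subbox weighting of the window graph on every `Dd` inside
the cut world and off the root cube `Q_0`** (no separation input: every vertex of the cut world lies in the ball).
[cite: KozmaNitzan2024, §4 p. 17 (subbox), p. 28 ((32) at the root)] -/
theorem isSubbox_W0sub_win (w₀ : V) (R : ℕ) {U Dd : Finset V} (hDU : Dd ⊆ U.filter fun y => y ∈ graphBall G w₀ R)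
    (hdis : Disjoint Dd (S.Γ.Q S.Γ.a₀ 0)) :
    KNLevels.IsSubbox (winGraph G w₀ R) (S.W0sub G (U.filter fun y => y ∈ graphBall G w₀ R)) S.p Dd :=
  isSubbox_W0sub_graph (winGraph G w₀ R) (winGraph_le G w₀ R) hDU hdis
    (fun _ hu _ hv hadj => (winGraph_adj G).2 ⟨hadj, (Finset.mem_filter.1 (hDU hu)).2, (Finset.mem_filter.1 (hDU hv)).2⟩)
    (fun _ hv _ hx _ hadj => (winGraph_adj G).2 ⟨hadj, (Finset.mem_filter.1 hx).2, (Finset.mem_filter.1 (hDU hv)).2⟩)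

end Skel

end Transplant

end Summit.CriticalPhenomena.PercolationContinuityZ3.Theorems

end
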